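import Summits.NavierStokesRegularity.NavierStokesRegularity.Theorems.ExtremiserTransienceNearExtremalTransienceExtremiserLiouvilleConstantSpeedBlowDownLimit
import HarnessLib

/-!
# Crux `ExtremiserTransience.NearExtremalTransience` (stmt-NavierStokesRegularity-21883), line `extremiser_liouville`,
# stub K1b — WEAK BLOW-DOWN LIMITS OF THE RESIDUE ARE ZERO (the kill is soft; blow-downs of a jet concentrate)

`--supports stmt-NavierStokesRegularity-21883` (helper).  Author: prover seat `ns-el-k1b` (g6).  Companion of
`…ConstantSpeedBlowDownLimit`: the proof that an `L²_loc` blow-down limit `U` of a K1b residue vanishes uses only (i) the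
convergence of the PAIRINGS `∫⟪Vₙ, Φ⟫ → ∫⟪U, Φ⟫` against continuous compactly supported `Φ` and (ii) the growth
`∫_{B_L}‖U‖² ≤ C L^θ`, `θ < 3`.  Hence:

* `ae_eq_zero_of_weaklyDivFree_of_curlFree_of_growth` : div–curl Liouville under sub-cubic `L²` growth;
* `blowDown_weakLimit_ae_eq_zero` : every pairings-limit (e.g. weak `L²_loc` limit) of blow-downs of a residue with sub-cubic
  growth is `0` a.e.

DIAGNOSIS recorded with it: for a residue JET of finite energy per unit length the blow-downs `V_R = R(v − c)(R·)` are bounded in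
`L²_loc`, so `V_R ⇀ 0` in `L²_loc`, while `‖V_R‖²_{L²(B_1)} = R⁻¹∫_{B_R}‖v − c‖² ↛ 0`: the family CONCENTRATES on the axis and has
NO strong `L²_loc` cluster point — the next object is the defect measure `w*-lim ‖V_R‖² dx` (a measure on the axis), not a limit
field.  WHAT THIS IS NOT: K1b is NOT proved; nothing here proves NS regularity. [folklore]
-/

noncomputable section

open Set Filter Topology MeasureTheory Metric Function
open scoped ENNReal NNReal Topology InnerProductSpace RealInnerProductSpace ContDiff Laplacian
open Literature.Analysis.FluidPDE Literature.Analysis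

namespace Summit.NavierStokesRegularity.NavierStokesRegularity.Theorems

-- the problem directory repeats the summit name (`NavierStokesRegularity/NavierStokesRegularity`)
set_option linter.dupNamespace false

namespace ExtremiserLiouville

open DepletionLadder.KStar DepletionLadder.KStar.HalfSpace

variable {v : E3 → E3} {c : E3}

/-- **`div`–`curl` Liouville under sub-cubic `L²` growth**: a locally integrable field `U : ℝ³ → ℝ³` which is weakly solenoidal,
annihilates every curl-type test field `(∂ₐg)c′ − (∂_{c′}g)a`, and satisfies `∫⁻_{B_L}‖U‖ₑ² ≤ C L^θ` (`L ≥ 1`, `θ ∈ [0,3)`)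
vanishes a.e. (its components are weakly harmonic; growth Liouville). [folklore] -/
theorem ae_eq_zero_of_weaklyDivFree_of_curlFree_of_growth {U : E3 → E3} (hU : AEStronglyMeasurable U volume)
    (hUl : LocallyIntegrable U volume) (hdivU : IsWeaklyDivFree U)
    (hcurlU : ∀ g : E3 → ℝ, FunctionSpaces.IsTestFunctionOn (⊤ : TopologicalSpace.Opens E3) g → ∀ a c' : E3,
      ∫ x, ⟪U x, fderiv ℝ g x a • c' - fderiv ℝ g x c' • a⟫_ℝ = 0)
    {C θ : ℝ} (hC : 0 ≤ C) (hθ0 : 0 ≤ θ) (hθ : θ < 3)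
    (hA : ∀ L : ℝ, 1 ≤ L → ∫⁻ x in ball (0 : E3) L, ‖U x‖ₑ ^ 2 ≤ ENNReal.ofReal (C * L ^ θ)) :
    U =ᵐ[volume] 0 :=
  ae_eq_zero_of_weaklyHarmonic_of_growth hU hC hθ0 hθ hA fun _ hϑ a =>
    integral_laplacian_mul_inner_eq_zero_of_curlPair hUl hdivU hcurlU hϑ a

/-- **Weak blow-down limits of the residue are zero.**  Same residue `(v, μ)` as in `blowDown_limit_ae_eq_zero` (NO growth
hypothesis on `v` needed), `Rₙ ≥ 1`, `Rₙ → ∞`.  If the pairings of the blow-downs `x ↦ Rₙ (v(Rₙ x) − c)` with every continuous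
compactly supported field `Φ` converge to those of a locally integrable `U` (e.g. a weak `L²_loc` limit), and
`∫⁻_{B_L}‖U‖ₑ² ≤ C L^θ` for `L ≥ 1` with `θ < 3`, then `U = 0` a.e.  CONSEQUENCE (informal): for a residue jet of finite
energy per unit length the blow-downs are bounded in `L²_loc`, every weak cluster point is `0`, so `V_R ⇀ 0` in `L²_loc` while
`‖V_R‖²_{L²(B_1)} ↛ 0` — the blow-downs CONCENTRATE (on the axis) rather than converge strongly; the object to analyse next is
the defect measure, not a limit field.  (K1b itself is NOT proved here.) [folklore] -/
theorem blowDown_weakLimit_ae_eq_zero (hv : ContDiff ℝ ∞ v) (hdiv : VectorCalculus.IsDivFree v) {M : ℝ}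
    (hM : ∀ x, ‖v x‖ = M) (h1 : ∫⁻ x, ‖iteratedFDeriv ℝ 1 v x‖ₑ ^ 2 < ⊤) (h2 : ∫⁻ x, ‖iteratedFDeriv ℝ 2 v x‖ₑ ^ 2 < ⊤)
    (hpos : 0 < M * Real.sqrt (Zen v) * Real.sqrt (Wpa v))
    (μ : Measure E3) [IsFiniteMeasure μ]
    (hμ : ∀ ψ : E3 → E3, ContDiff ℝ ∞ ψ → HasCompactSupport ψ → VectorCalculus.IsDivFree ψ →
      Jst v * J1 v ψ - kStar ^ 2 * M ^ 2 * (Wpa v * A1 v ψ + Zen v * C1 v ψ) = ∫ x, ⟪v x, ψ x⟫_ℝ ∂μ)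
    (hc : c ≠ 0) (hcM : ‖c‖ = M) (hL6 : MemLp (fun x => v x - c) 6 volume)
    {Rn : ℕ → ℝ} (hRn1 : ∀ n, 1 ≤ Rn n) (hRn : Tendsto Rn atTop atTop)
    {U : E3 → E3} (hU : AEStronglyMeasurable U volume) (hUl : LocallyIntegrable U volume)
    (hweak : ∀ Φ : E3 → E3, Continuous Φ → HasCompactSupport Φ →
      Tendsto (fun n => ∫ x, ⟪Rn n • (v (Rn n • x) - c), Φ x⟫_ℝ) atTop (𝓝 (∫ x, ⟪U x, Φ x⟫_ℝ)))
    {C θ : ℝ} (hC : 0 ≤ C) (hθ0 : 0 ≤ θ) (hθ : θ < 3)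
    (hA : ∀ L : ℝ, 1 ≤ L → ∫⁻ x in ball (0 : E3) L, ‖U x‖ₑ ^ 2 ≤ ENNReal.ofReal (C * L ^ θ)) :
    U =ᵐ[volume] 0 := by
  have hRn0 : ∀ n, 0 < Rn n := fun n => one_pos.trans_le (hRn1 n)
  have hv1 : ContDiff ℝ 1 v := hv.of_le (by exact_mod_cast le_top)
  have huniq : ∀ Φ : E3 → E3, Continuous Φ → HasCompactSupport Φ →
      Tendsto (fun n => ∫ x, ⟪Rn n • (v (Rn n • x) - c), Φ x⟫_ℝ) atTop (𝓝 0) → ∫ x, ⟪U x, Φ x⟫_ℝ = 0 :=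
    fun Φ hΦ hΦc h0 => tendsto_nhds_unique (hweak Φ hΦ hΦc) h0
  -- weakly solenoidal
  have hdivU : IsWeaklyDivFree U := by
    intro θ' hθ'
    have hθ1 : ContDiff ℝ 1 θ' := hθ'.contDiff.of_le (by exact_mod_cast le_top)
    have hgc : Continuous (gradient θ') := by
      unfold gradient
      exact (InnerProductSpace.toDual ℝ E3).symm.continuous.comp (hθ1.continuous_fderiv one_ne_zero)
    have hgs : HasCompactSupport (gradient θ') :=
      (hθ'.hasCompactSupport.fderiv (𝕜 := ℝ)).comp_left (g := (InnerProductSpace.toDual ℝ E3).symm) (map_zero _)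
    refine huniq _ hgc hgs (tendsto_const_nhds.congr' (Eventually.of_forall fun n => ?_))
    exact (VectorCalculus.IsDivFree.isWeaklyDivFree_holds (isDivFree_blowDown (hv1.differentiable one_ne_zero) hdiv c (Rn n))
      (contDiff_blowDown hv1 c (Rn n)) θ' hθ').symm
  -- annihilates curl-type test fields (g6's vorticity law)
  have hcurlU : ∀ g : E3 → ℝ, FunctionSpaces.IsTestFunctionOn (⊤ : TopologicalSpace.Opens E3) g → ∀ a c' : E3,
      ∫ x, ⟪U x, fderiv ℝ g x a • c' - fderiv ℝ g x c' • a⟫_ℝ = 0 := by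
    intro g hg a c'
    have hg1 : ContDiff ℝ 1 g := hg.contDiff.of_le (by exact_mod_cast le_top)
    have hDg : Continuous (fderiv ℝ g) := hg1.continuous_fderiv one_ne_zero
    have hΦc : Continuous fun x => fderiv ℝ g x a • c' - fderiv ℝ g x c' • a :=
      ((hDg.clm_apply continuous_const).smul continuous_const).sub ((hDg.clm_apply continuous_const).smul continuous_const)
    have hΦs : HasCompactSupport fun x => fderiv ℝ g x a • c' - fderiv ℝ g x c' • a :=
      (hg.hasCompactSupport.fderiv (𝕜 := ℝ)).mono fun x hx => by
        rw [mem_support] at hx ⊢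
        intro h0; exact hx (by rw [h0]; simp)
    have hB : ContDiff ℝ ∞ fun y => g y • cross c' a := hg.contDiff.smul contDiff_const
    have hBc : HasCompactSupport fun y => g y • cross c' a := hg.hasCompactSupport.smul_right
    have hT := (tendsto_blowDown_vorticity_zero_general hv hdiv hM h1 h2 hpos μ hμ hc hcM hL6 hB hBc).comp hRn
    refine huniq _ hΦc hΦs (hT.congr fun n => ?_)
    show (Rn n)⁻¹ * ∫ y, ⟪curl v y, g ((Rn n)⁻¹ • y) • cross c' a⟫_ℝ =
      ∫ x, ⟪Rn n • (v (Rn n • x) - c), fderiv ℝ g x a • c' - fderiv ℝ g x c' • a⟫_ℝ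
    exact (integral_inner_curlPair_blowDown hv1 c hg1 hg.hasCompactSupport a c' (hRn0 n)).symm
  exact ae_eq_zero_of_weaklyDivFree_of_curlFree_of_growth hU hUl hdivU hcurlU hC hθ0 hθ hA

end ExtremiserLiouville

end Summit.NavierStokesRegularity.NavierStokesRegularity.Theorems

end
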